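import Mathlib
import Literature.Analysis.FluidPDE.SelfSimilarEulerProfileVorticity
import Literature.Analysis.FluidPDE.ParticleTrajectoryFlow
import Literature.Analysis.FluidPDE.ParticleTrajectoryFlowJacobian
import Literature.Analysis.FluidPDE.TrajectoryJacobianLiouville
import Literature.Analysis.FluidPDE.TrajectoryGradientBound
import Literature.Analysis.FluidPDE.SpaceTimeCalculusC1
import Literature.Analysis.FluidPDE.CaloricRemainderCalculus
import Literature.Analysis.FluidPDE.WholeSpaceIBP
import HarnessLib.Audit

/-!
# Rung C1 of the crux `EulerZoomLiouville.PowerGaugeEulerLiouville`: the SELF-SIMILAR LAGRANGIAN FLOW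
# (Jacobian `e^{3γs}`, outgoing far trajectories, gradient growth `e^{(γ+ε)s}`) — toolkit for the Kelvin law

Route №10 `EulerZoomLiouville` (NavierStokesRegularity), crux E = stmt-NavierStokesRegularity-19832,
tenure rung C1 (exactly self-similar members), registered residue `stub_selfSimilarExtremal`.
PROFILE-LEVEL Lagrangian toolkit for a classical stationary self-similar Euler profile
`(V, P)` (`IsSelfSimilarEulerProfile γ 0 V P`: `(1−γ)V + ((γy + V)·∇)V + ∇P = 0`, `div V = 0`,
CIV 2026 (3.3)) with `V` smooth, `‖DV‖ ≤ K`: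

* the self-similar Lagrangian field `W = γy + V` (`selfSimilarTransport γ 0 V`) as a
  time-independent velocity field: smooth, uniformly Lipschitz, `div W = 3γ`; its flow
  `Φ_s = ODE.evolutionMap (fun _ => W) 0 s` (the tree's particle-trajectory map);
* `det_fderiv_flow` — **the Jacobian is `det DΦ_s = e^{3γs}`** (CIV (3.22), Liouville's formula);
* `norm_flow_ge` / `norm_flow_le` — **every far trajectory is outgoing**:
  `e^{γs}(‖y‖ − M/γ) ≤ ‖Φ_s y‖ ≤ e^{γs}(‖y‖ + M/γ)` for `s ≥ 0`, `M = sup ‖V‖`;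
* `norm_fderiv_flow_le_exp` — `‖DΦ_s(y)‖ ≤ e^{(γ+ε)s}` when `‖DV‖ ≤ ε` beyond the radius
  `‖y‖ − M/γ` (Grönwall on `e^{−γs}DΦ_s`, whose derivative is `DV(Φ_s y) ∘ (e^{−γs}DΦ_s)`);
* (sequel `…SelfSimilarKelvin`: the self-similar Kelvin law `∫ ⟪V(Φ_s y), DΦ_s(y) B(y)⟫ dy =
  e^{(2γ−1)s} ∫ ⟪V, B⟫` for compactly supported divergence-free `B`, CIV 2026 §3.4.2.)

The sequel `…SelfSimilarKelvinFarField` turns this into: at the energy-conserving endpoint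
`γ = 2/5` (`ρ = 1/2`), polynomial decay of the tail energy `∫_{|x|>R}|V|²` forces `curl V` to
have compact support, whence (tree, `selfSimilar_ae_eq_zero_of_hasCompactSupport_curl`) the
member is trivial — the classical endpoint stratum of `stub_selfSimilarExtremal`
(Chae–Wolf 2020 Cor. 1.5 in the self-similar case, by a new elementary route, without the
named fact `chaeWolf2020_dss_energyConservingScale`).

WHAT THIS IS NOT: not NS, not E, not rung C1 — Lagrangian bookkeeping for CLASSICAL (smooth,
bounded-gradient) profiles only.

## References

* P. Constantin, M. Ignatova, V. Vicol, arXiv:2602.17570 (2026), §3.4.1 (3.21)–(3.22) (self-similar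
  Lagrangian flow, `det ∇_a Y = e^{3γτ}`), §3.4.2 (self-similar Kelvin theorem, Remark 3.6).
  [ConstantinIgnatovaVicol2026Putative]
* A. J. Majda, A. L. Bertozzi, *Vorticity and Incompressible Flow*, CUP 2002, §1.3 (the tree's
  particle-trajectory files). [MajdaBertozziCUP2002]
-/

noncomputable section

-- flat `Theorems/<Route><Decl>…` files of one crux share the namespace of the crux (tree convention)
set_option linter.dupNamespace false

open MeasureTheory Set Filter Topology Metric Function InnerProductSpace
open scoped RealInnerProductSpace NNReal ContDiff

namespace Summit.NavierStokesRegularity.NavierStokesRegularity.Theorems.PowerGaugeEulerLiouville.Kelvin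

open Literature.Analysis Literature.Analysis.FluidPDE

variable {γ : ℝ} {V : EuclideanSpace ℝ (Fin 3) → EuclideanSpace ℝ (Fin 3)}

/-! ### The self-similar Lagrangian field `W = γy + V` as a (time-independent) velocity field -/

/-- `W = γy + V` is `C^n` when `V` is. [cite: ConstantinIgnatovaVicol2026Putative, §3.4 eq. (3.19)] -/
theorem contDiff_selfSimilarTransport {n : WithTop ℕ∞} (hV : ContDiff ℝ n V) :
    ContDiff ℝ n (selfSimilarTransport γ 0 V) := by
  have h : ContDiff ℝ n fun y : EuclideanSpace ℝ (Fin 3) => γ • (y - 0) + V y :=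
    ((contDiff_id.sub contDiff_const).const_smul γ).add hV
  exact h

/-- `W`, viewed as a time-independent velocity field, is jointly smooth on the time set `univ`.
[cite: ConstantinIgnatovaVicol2026Putative, §3.4 eq. (3.21)] -/
theorem isSmoothSpaceTimeOn_transport (hV : ContDiff ℝ ∞ V) :
    IsSmoothSpaceTimeOn univ (fun _ : ℝ => selfSimilarTransport γ 0 V) := by
  refine IsSmoothSpaceTimeOn.of_contDiff_univ ?_
  have h : ContDiff ℝ (⊤ : ℕ∞) (selfSimilarTransport γ 0 V ∘ Prod.snd :
      ℝ × EuclideanSpace ℝ (Fin 3) → EuclideanSpace ℝ (Fin 3)) :=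
    (contDiff_selfSimilarTransport hV).comp contDiff_snd
  exact h

/-- `‖DW(y)‖ ≤ |γ| + K` when `‖DV‖ ≤ K` (`DW = γ I + DV`). [cite: ConstantinIgnatovaVicol2026Putative, §3.4 eq. (3.19)] -/
theorem norm_fderiv_selfSimilarTransport_le (hV : Differentiable ℝ V) {K : ℝ}
    (hK : ∀ y, ‖fderiv ℝ V y‖ ≤ K) (y : EuclideanSpace ℝ (Fin 3)) :
    ‖fderiv ℝ (selfSimilarTransport γ 0 V) y‖ ≤ |γ| + K := by
  rw [(hasFDerivAt_selfSimilarTransport hV y).fderiv]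
  refine (norm_add_le _ _).trans (add_le_add ?_ (hK y))
  rw [norm_smul, Real.norm_eq_abs]
  exact mul_le_of_le_one_right (abs_nonneg γ) ContinuousLinearMap.norm_id_le

/-- `W` satisfies the Cauchy–Lipschitz hypotheses on the time set `univ` when `‖DV‖ ≤ K`.
[cite: MajdaBertozziCUP2002, §4.2 proof of Thm. 4.3 (bounded gradient ⇒ trajectories)] -/
theorem isUniformlyLipschitzOn_transport (hV : ContDiff ℝ ∞ V) {K : ℝ}
    (hK : ∀ y, ‖fderiv ℝ V y‖ ≤ K) :
    ODE.IsUniformlyLipschitzOn (fun _ : ℝ => selfSimilarTransport γ 0 V) univ :=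
  (isSmoothSpaceTimeOn_transport hV).isUniformlyLipschitzOn_of_norm_fderiv_le' (M := |γ| + K)
    fun _ _ y => norm_fderiv_selfSimilarTransport_le (hV.differentiable (by simp)) hK y

/-! ### The self-similar Lagrangian flow `Φ_s` -/

/-- **(3.21)**: `d/ds Φ_s(y) = W(Φ_s(y))`. [cite: ConstantinIgnatovaVicol2026Putative, §3.4.1 eq. (3.21)] -/
theorem hasDerivAt_flow (hV : ContDiff ℝ ∞ V) {K : ℝ} (hK : ∀ y, ‖fderiv ℝ V y‖ ≤ K)
    (s : ℝ) (y : EuclideanSpace ℝ (Fin 3)) :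
    HasDerivAt (fun r => ODE.evolutionMap (fun _ : ℝ => selfSimilarTransport γ 0 V) 0 r y)
      (selfSimilarTransport γ 0 V
        (ODE.evolutionMap (fun _ : ℝ => selfSimilarTransport γ 0 V) 0 s y)) s :=
  ((isUniformlyLipschitzOn_transport hV hK).hasDerivWithinAt_evolutionMap convex_univ
    (mem_univ _) (mem_univ _) y).hasDerivAt univ_mem

/-- The flow is jointly smooth on `univ × ℝ³`. [cite: MajdaBertozziCUP2002, §4.1 eq. (4.3)] -/
theorem isSmoothSpaceTimeOn_flow (hV : ContDiff ℝ ∞ V) {K : ℝ} (hK : ∀ y, ‖fderiv ℝ V y‖ ≤ K) :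
    IsSmoothSpaceTimeOn univ (ODE.evolutionMap (fun _ : ℝ => selfSimilarTransport γ 0 V) 0) :=
  isSmoothSpaceTimeOn_evolutionMap (isUniformlyLipschitzOn_transport hV hK)
    (isSmoothSpaceTimeOn_transport hV) convex_univ uniqueDiffOn_univ (mem_univ _)

/-- Each `Φ_s` is smooth. [cite: MajdaBertozziCUP2002, §1.3 (1.13)–(1.14)] -/
theorem contDiff_flow (hV : ContDiff ℝ ∞ V) {K : ℝ} (hK : ∀ y, ‖fderiv ℝ V y‖ ≤ K) (s : ℝ) :
    ContDiff ℝ ∞ (ODE.evolutionMap (fun _ : ℝ => selfSimilarTransport γ 0 V) 0 s) :=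
  contDiff_evolutionMap_slice (isUniformlyLipschitzOn_transport hV hK)
    (isSmoothSpaceTimeOn_transport hV) convex_univ uniqueDiffOn_univ (mem_univ _) (mem_univ _)

/-- **(3.22), the Jacobian: `det DΦ_s = e^{3γs}`** (`div W = 3γ`, Liouville's formula).
[cite: ConstantinIgnatovaVicol2026Putative, §3.4.1 eq. (3.22) (remark after)] -/
theorem det_fderiv_flow (hV : ContDiff ℝ ∞ V) {K : ℝ} (hK : ∀ y, ‖fderiv ℝ V y‖ ≤ K)
    (hdiv : VectorCalculus.IsDivFree V) {s : ℝ} (hs : 0 ≤ s) (a : EuclideanSpace ℝ (Fin 3)) :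
    (fderiv ℝ (ODE.evolutionMap (fun _ : ℝ => selfSimilarTransport γ 0 V) 0 s) a).det =
      Real.exp (3 * γ * s) := by
  rw [det_fderiv_evolutionMap_eq_exp_integral_divergence (isUniformlyLipschitzOn_transport hV hK)
    (isSmoothSpaceTimeOn_transport hV) convex_univ uniqueDiffOn_univ (mem_univ _) (mem_univ _)
    hs a]
  congr 1
  have hd : ∀ r : ℝ, VectorCalculus.divergence (selfSimilarTransport γ 0 V)
      (ODE.evolutionMap (fun _ : ℝ => selfSimilarTransport γ 0 V) 0 r a) = 3 * γ := fun r =>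
    divergence_selfSimilarTransport (hV.differentiable (by simp)) hdiv _
  simp_rw [hd, intervalIntegral.integral_const, smul_eq_mul]
  ring


/-! ### Every far trajectory is outgoing -/

/-- **The renormalised trajectory `ψ(s) = e^{−γs} Φ_s(y)` moves at speed `e^{−γs}‖V‖ ≤ M e^{−γs}`,
so `‖ψ(s) − y‖ ≤ (M/γ)(1 − e^{−γs})` for `s ≥ 0`.** [cite: ConstantinIgnatovaVicol2026Putative, §3.4.1 eq. (3.21)] -/
theorem norm_exp_neg_smul_flow_sub_le (hV : ContDiff ℝ ∞ V) {K : ℝ} (hK : ∀ y, ‖fderiv ℝ V y‖ ≤ K)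
    {M : ℝ} (hM : ∀ y, ‖V y‖ ≤ M) (hγ : 0 < γ) {s : ℝ} (hs : 0 ≤ s)
    (y : EuclideanSpace ℝ (Fin 3)) :
    ‖Real.exp (-γ * s) • ODE.evolutionMap (fun _ : ℝ => selfSimilarTransport γ 0 V) 0 s y - y‖ ≤
      M / γ * (1 - Real.exp (-γ * s)) := by
  set Φ := ODE.evolutionMap (fun _ : ℝ => selfSimilarTransport γ 0 V) 0 with hΦ
  -- the renormalised trajectory and its derivative
  have hder : ∀ r, HasDerivAt (fun r => Real.exp (-γ * r) • Φ r y - y)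
      (Real.exp (-γ * r) • V (Φ r y)) r := by
    intro r
    have h1 : HasDerivAt (fun r => Real.exp (-γ * r)) (Real.exp (-γ * r) * (-γ)) r := by
      simpa using ((hasDerivAt_id r).const_mul (-γ)).exp
    have h2 := hasDerivAt_flow (γ := γ) hV hK r y
    refine ((h1.smul h2).sub_const y).congr_deriv ?_
    simp only [hΦ, selfSimilarTransport_apply, sub_zero, smul_add, smul_smul]
    module
  have hBder : ∀ r, HasDerivAt (fun r => M / γ * (1 - Real.exp (-γ * r)))
      (M * Real.exp (-γ * r)) r := by
    intro r
    have h1 : HasDerivAt (fun r => Real.exp (-γ * r)) (Real.exp (-γ * r) * (-γ)) r := by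
      simpa using ((hasDerivAt_id r).const_mul (-γ)).exp
    refine ((h1.const_sub 1).const_mul (M / γ)).congr_deriv ?_
    field_simp
  have hM0 : 0 ≤ M := (norm_nonneg _).trans (hM 0)
  have h0 : ‖Real.exp (-γ * 0) • Φ 0 y - y‖ ≤ M / γ * (1 - Real.exp (-γ * 0)) := by
    simp [hΦ, ODE.evolutionMap_self]
  have key := image_norm_le_of_norm_deriv_right_le_deriv_boundary
    (f := fun r => Real.exp (-γ * r) • Φ r y - y) (f' := fun r => Real.exp (-γ * r) • V (Φ r y))
    (a := 0) (b := s) (B := fun r => M / γ * (1 - Real.exp (-γ * r)))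
    (B' := fun r => M * Real.exp (-γ * r))
    (fun r _ => (hder r).continuousAt.continuousWithinAt)
    (fun r _ => (hder r).hasDerivWithinAt) h0 (fun r => hBder r)
    (fun r _ => by
      rw [norm_smul, Real.norm_eq_abs, abs_of_pos (Real.exp_pos _), mul_comm]
      exact mul_le_mul_of_nonneg_right (hM _) (Real.exp_pos _).le)
  exact key (right_mem_Icc.2 hs)

/-- **Outgoing lower bound**: `e^{γs}(‖y‖ − M/γ) ≤ ‖Φ_s(y)‖` for `s ≥ 0` (`M = sup ‖V‖`, `γ > 0`).
[cite: ConstantinIgnatovaVicol2026Putative, §3.4.1 eq. (3.21)] -/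
theorem norm_flow_ge (hV : ContDiff ℝ ∞ V) {K : ℝ} (hK : ∀ y, ‖fderiv ℝ V y‖ ≤ K)
    {M : ℝ} (hM : ∀ y, ‖V y‖ ≤ M) (hγ : 0 < γ) {s : ℝ} (hs : 0 ≤ s)
    (y : EuclideanSpace ℝ (Fin 3)) :
    Real.exp (γ * s) * (‖y‖ - M / γ) ≤
      ‖ODE.evolutionMap (fun _ : ℝ => selfSimilarTransport γ 0 V) 0 s y‖ := by
  set z := ODE.evolutionMap (fun _ : ℝ => selfSimilarTransport γ 0 V) 0 s y with hz
  have h := norm_exp_neg_smul_flow_sub_le (γ := γ) hV hK hM hγ hs y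
  rw [← hz] at h
  have hM0 : 0 ≤ M := (norm_nonneg _).trans (hM 0)
  have h1 : ‖Real.exp (-γ * s) • z - y‖ ≤ M / γ :=
    h.trans (mul_le_of_le_one_right (div_nonneg hM0 hγ.le) (by linarith [Real.exp_pos (-γ * s)]))
  have h2 : ‖y‖ - M / γ ≤ ‖Real.exp (-γ * s) • z‖ := by
    have := norm_sub_norm_le y (Real.exp (-γ * s) • z)
    rw [← norm_neg, neg_sub] at h1
    linarith
  rw [norm_smul, Real.norm_eq_abs, abs_of_pos (Real.exp_pos _)] at h2
  have h3 : Real.exp (γ * s) * (Real.exp (-γ * s) * ‖z‖) = ‖z‖ := by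
    rw [← mul_assoc, ← Real.exp_add]; simp
  calc Real.exp (γ * s) * (‖y‖ - M / γ) ≤ Real.exp (γ * s) * (Real.exp (-γ * s) * ‖z‖) :=
        mul_le_mul_of_nonneg_left h2 (Real.exp_pos _).le
    _ = ‖z‖ := h3

/-- **Outgoing upper bound**: `‖Φ_s(y)‖ ≤ e^{γs}(‖y‖ + M/γ)` for `s ≥ 0`.
[cite: ConstantinIgnatovaVicol2026Putative, §3.4.1 eq. (3.21)] -/
theorem norm_flow_le (hV : ContDiff ℝ ∞ V) {K : ℝ} (hK : ∀ y, ‖fderiv ℝ V y‖ ≤ K)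
    {M : ℝ} (hM : ∀ y, ‖V y‖ ≤ M) (hγ : 0 < γ) {s : ℝ} (hs : 0 ≤ s)
    (y : EuclideanSpace ℝ (Fin 3)) :
    ‖ODE.evolutionMap (fun _ : ℝ => selfSimilarTransport γ 0 V) 0 s y‖ ≤
      Real.exp (γ * s) * (‖y‖ + M / γ) := by
  set z := ODE.evolutionMap (fun _ : ℝ => selfSimilarTransport γ 0 V) 0 s y with hz
  have h := norm_exp_neg_smul_flow_sub_le (γ := γ) hV hK hM hγ hs y
  rw [← hz] at h
  have hM0 : 0 ≤ M := (norm_nonneg _).trans (hM 0)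
  have h1 : ‖Real.exp (-γ * s) • z - y‖ ≤ M / γ :=
    h.trans (mul_le_of_le_one_right (div_nonneg hM0 hγ.le) (by linarith [Real.exp_pos (-γ * s)]))
  have h2 : ‖Real.exp (-γ * s) • z‖ ≤ ‖y‖ + M / γ := by
    have := norm_le_norm_add_norm_sub' (Real.exp (-γ * s) • z) y
    linarith
  rw [norm_smul, Real.norm_eq_abs, abs_of_pos (Real.exp_pos _)] at h2
  have h3 : Real.exp (γ * s) * (Real.exp (-γ * s) * ‖z‖) = ‖z‖ := by
    rw [← mul_assoc, ← Real.exp_add]; simp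
  calc ‖z‖ = Real.exp (γ * s) * (Real.exp (-γ * s) * ‖z‖) := h3.symm
    _ ≤ Real.exp (γ * s) * (‖y‖ + M / γ) := mul_le_mul_of_nonneg_left h2 (Real.exp_pos _).le

/-! ### The gradient of the flow along far trajectories -/

/-- **The variational equation**: `d/ds DΦ_s(y) = (γ I + DV(Φ_s y)) ∘ DΦ_s(y)`.
[cite: ConstantinIgnatovaVicol2026Putative, §3.4.1 eq. (3.22); MajdaBertozziCUP2002, §4.2 eq. (4.45)] -/
theorem hasDerivAt_fderiv_flow (hV : ContDiff ℝ ∞ V) {K : ℝ} (hK : ∀ y, ‖fderiv ℝ V y‖ ≤ K)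
    (s : ℝ) (y : EuclideanSpace ℝ (Fin 3)) :
    HasDerivAt (fun r => fderiv ℝ (ODE.evolutionMap (fun _ : ℝ => selfSimilarTransport γ 0 V) 0 r) y)
      ((γ • ContinuousLinearMap.id ℝ (EuclideanSpace ℝ (Fin 3)) +
          fderiv ℝ V (ODE.evolutionMap (fun _ : ℝ => selfSimilarTransport γ 0 V) 0 s y)).comp
        (fderiv ℝ (ODE.evolutionMap (fun _ : ℝ => selfSimilarTransport γ 0 V) 0 s) y)) s := by
  have h := (hasDerivWithinAt_fderiv_evolutionMap (u := fun _ : ℝ => selfSimilarTransport γ 0 V)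
    (isUniformlyLipschitzOn_transport hV hK) (isSmoothSpaceTimeOn_transport hV) convex_univ
    uniqueDiffOn_univ (mem_univ (0 : ℝ)) (mem_univ s) y).hasDerivAt univ_mem
  rwa [(hasFDerivAt_selfSimilarTransport (hV.differentiable (by simp)) _).fderiv] at h

/-- **`‖DΦ_s(y)‖ ≤ e^{(γ+ε)s}` along a trajectory that stays where `‖DV‖ ≤ ε`**: if
`‖DV(z)‖ ≤ ε` for `‖z‖ ≥ R` and `‖y‖ − M/γ ≥ R`, then for `s ≥ 0`, `‖DΦ_s(y)‖ ≤ e^{(γ+ε)s}`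
(Grönwall for `e^{−γs}DΦ_s(y)`, whose derivative is `DV(Φ_s y) ∘ e^{−γs}DΦ_s(y)`).
[cite: MajdaBertozziCUP2002, §4.2 eq. (4.47)] -/
theorem norm_fderiv_flow_le_exp (hV : ContDiff ℝ ∞ V) {K : ℝ} (hK : ∀ y, ‖fderiv ℝ V y‖ ≤ K)
    {M : ℝ} (hM : ∀ y, ‖V y‖ ≤ M) (hγ : 0 < γ) {ε R : ℝ}
    (hε : ∀ z : EuclideanSpace ℝ (Fin 3), R ≤ ‖z‖ → ‖fderiv ℝ V z‖ ≤ ε)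
    {y : EuclideanSpace ℝ (Fin 3)} (hy : R ≤ ‖y‖ - M / γ) {s : ℝ} (hs : 0 ≤ s) :
    ‖fderiv ℝ (ODE.evolutionMap (fun _ : ℝ => selfSimilarTransport γ 0 V) 0 s) y‖ ≤
      Real.exp ((γ + ε) * s) := by
  set Φ := ODE.evolutionMap (fun _ : ℝ => selfSimilarTransport γ 0 V) 0 with hΦ
  set f : ℝ → (EuclideanSpace ℝ (Fin 3) →L[ℝ] EuclideanSpace ℝ (Fin 3)) :=
    fun r => Real.exp (-γ * r) • fderiv ℝ (Φ r) y with hf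
  set f' : ℝ → (EuclideanSpace ℝ (Fin 3) →L[ℝ] EuclideanSpace ℝ (Fin 3)) :=
    fun r => (fderiv ℝ V (Φ r y)).comp (f r) with hf'
  have hder : ∀ r, HasDerivAt f (f' r) r := by
    intro r
    have h1 : HasDerivAt (fun r => Real.exp (-γ * r)) (Real.exp (-γ * r) * (-γ)) r := by
      simpa using ((hasDerivAt_id r).const_mul (-γ)).exp
    have h2 := hasDerivAt_fderiv_flow (γ := γ) hV hK r y
    refine (h1.smul h2).congr_deriv ?_
    simp only [hf', hf, hΦ, ContinuousLinearMap.add_comp, ContinuousLinearMap.smul_comp,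
      ContinuousLinearMap.id_comp, ContinuousLinearMap.comp_smul, smul_add, smul_smul]
    module
  -- far away the coefficient is at most `ε`
  have hfar : ∀ r, 0 ≤ r → R ≤ ‖Φ r y‖ := by
    intro r hr
    by_cases hnn : 0 ≤ ‖y‖ - M / γ
    · have h1 := norm_flow_ge (γ := γ) hV hK hM hγ hr y
      have h2 : ‖y‖ - M / γ ≤ Real.exp (γ * r) * (‖y‖ - M / γ) :=
        le_mul_of_one_le_left hnn (Real.one_le_exp (by positivity))
      exact hy.trans (h2.trans h1)
    · push Not at hnn
      exact ((hy.trans hnn.le).trans (norm_nonneg _))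
  have hb : ∀ r ∈ uIcc 0 s, ‖f' r‖ ≤ ε * ‖f r‖ := by
    intro r hr
    rw [uIcc_of_le hs] at hr
    exact (ContinuousLinearMap.opNorm_comp_le _ _).trans
      (mul_le_mul_of_nonneg_right (hε _ (hfar r hr.1)) (norm_nonneg _))
  have key := norm_le_mul_exp_of_norm_deriv_le_uIcc (K := ε) (f := f) (f' := f') (t₀ := 0) (t := s)
    (fun r _ => (hder r).hasDerivWithinAt) hb
  have hf0 : ‖f 0‖ ≤ 1 := by
    simp only [hf, hΦ, mul_zero, Real.exp_zero, one_smul, fderiv_evolutionMap_self]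
    exact ContinuousLinearMap.norm_id_le
  rw [sub_zero, abs_of_nonneg hs] at key
  have h1 : ‖f s‖ ≤ Real.exp (ε * s) :=
    key.trans ((mul_le_of_le_one_left (Real.exp_pos _).le hf0))
  have h2 : fderiv ℝ (Φ s) y = Real.exp (γ * s) • f s := by
    simp only [hf, smul_smul, ← Real.exp_add]
    simp
  rw [h2, norm_smul, Real.norm_eq_abs, abs_of_pos (Real.exp_pos _), add_mul, Real.exp_add]
  exact mul_le_mul_of_nonneg_left h1 (Real.exp_pos _).le


end Summit.NavierStokesRegularity.NavierStokesRegularity.Theorems.PowerGaugeEulerLiouville.Kelvin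

end
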